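import Mathlib.LinearAlgebra.DirectSum.Finsupp
import Mathlib.LinearAlgebra.FreeModule.Basic
import Mathlib.RepresentationTheory.Intertwining
import Literature.NumberTheory.Automorphic.HeckeAlgebra
import Literature.NumberTheory.Automorphic.ParabolicInductionAdmissibleProofs
import HarnessLib

/-!
# Hecke eigen-scalars pass through `Θ ⊗ 1_M` and along isomorphisms of representations

Topic `NumberTheory/Automorphic`; generic sequel to `HeckeAlgebra` (the double-coset operators
`heckeOperator ρ K g = ∑_{yK ⊆ KgK} ρ(y)` on `K`-fixed vectors).  Everything here is PROVED (no definition, no named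
fact, no instance); count-neutral.  It is the linear-algebra half of the sentence «a representation of a local group on a
GLOBAL space of the shape `Θ_v ⊗ M` (`M` with trivial action — the away-from-`v` factors) has, on its `K_v`-fixed
vectors, the Hecke eigenvalues of the LOCAL representation `Θ_v`» (Flath 1979, §2 Example 2; Bump Thm. 3.4.4; Cartier
Corvallis 1979 §IV.1), used by the d6 line of cell hodgecm-mathlib to read the level-`K` operators `T_w, S_w` at a split place
through the local theta quotient:

* `heckeOperator_tprod_trivial` — for a finite double coset `K t K / K`, as endomorphisms of `V ⊗ M`:
  `[K t K]_{Θ ⊗ 1_M} = [K t K]_Θ ⊗ id_M`;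
* `mem_fixedPoints_of_mem_fixedPoints_tprod_trivial` — along a basis `b` of `M`, every coordinate of a `K`-fixed vector
  of `Θ ⊗ 1_M` is a `K`-fixed vector of `Θ`;
* `heckeOperator_tprod_trivial_apply_eq_smul` — **if `[K t K]_Θ` acts by the scalar `λ` on `Θ^K`, then `[K t K]_{Θ ⊗ 1_M}`
  acts by `λ` on `(Θ ⊗ 1_M)^K`** (`M` free, e.g. any vector space);
* `heckeOperator_equiv_apply`, `heckeOperator_apply_eq_smul_of_equiv` — an isomorphism of representations `e : π ≃ σ`
  intertwines the Hecke operators (common transversal), so eigen-scalars on `π^K` are eigen-scalars on `σ^K`.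

## References
* D. Flath, *Decomposition of representations into tensor products*, Corvallis 1979, part 1, §2 Example 2 [Flath1979].
* D. Bump, *Automorphic forms and representations* (1997), Thm. 3.4.4 [Bump1997].
* P. Cartier, *Representations of 𝔭-adic groups: a survey*, PSPM 33 (1979), part 1, §IV.1 [CartierCorvallis1979].
-/

noncomputable section

open MulAction TensorProduct

namespace Literature.NumberTheory.Automorphic

section TensorTrivial

variable {k G V M : Type*} [CommRing k] [Group G] [AddCommGroup V] [Module k V] [AddCommGroup M] [Module k M]
  (Θ : Representation k G V) (K : Subgroup G)

/-- `(Θ ⊗ 1_M)(g) = Θ(g) ⊗ id_M` (`LinearMap.rTensor`). [cite: Flath1979, §2 Example 2] -/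
theorem tprod_trivial_apply (g : G) :
    Θ.tprod (Representation.trivial k G M) g = (Θ g).rTensor M := by
  refine TensorProduct.ext' fun v m => ?_
  rw [Representation.tprod_apply, TensorProduct.map_tmul, LinearMap.rTensor_tmul]
  rfl

/-- **`[K t K]_{Θ ⊗ 1_M} = [K t K]_Θ ⊗ id_M`** for a finite double coset (both sides are the finite sum of the
`Θ(y) ⊗ id_M` over one set of coset representatives). [cite: Flath1979, §2 Example 2] -/
theorem heckeOperator_tprod_trivial (t : G) (hfin : (orbit K (t : G ⧸ K)).Finite) :
    heckeOperator (Θ.tprod (Representation.trivial k G M)) K t = (heckeOperator Θ K t).rTensor M := by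
  classical
  rw [heckeOperator, heckeOperator, finsum_mem_eq_finite_toFinset_sum _ hfin,
    finsum_mem_eq_finite_toFinset_sum _ hfin]
  change _ = LinearMap.rTensorHom M (∑ i ∈ hfin.toFinset, Θ i.out)
  rw [map_sum]
  exact Finset.sum_congr rfl fun y _ => tprod_trivial_apply Θ y.out

variable {ι : Type*} [DecidableEq ι] (b : Module.Basis ι k M)

/-- Naturality in `V` of the coordinate isomorphism `V ⊗ M ≃ (ι →₀ V)` along a basis `b` of `M`:
`coord (f ⊗ id) z = (coord z).mapRange f`. [folklore] -/
private theorem coord_rTensor (f : V →ₗ[k] V) (z : V ⊗[k] M) :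
    (TensorProduct.congr (LinearEquiv.refl k V) b.repr).trans (finsuppScalarRight k k V ι) (f.rTensor M z) =
      Finsupp.mapRange f f.map_zero
        ((TensorProduct.congr (LinearEquiv.refl k V) b.repr).trans (finsuppScalarRight k k V ι) z) := by
  induction z using TensorProduct.induction_on with
  | zero => rw [map_zero, map_zero, Finsupp.mapRange_zero]
  | tmul v m =>
      ext i
      rw [LinearMap.rTensor_tmul, Finsupp.mapRange_apply]
      change finsuppScalarRight k k V ι (f v ⊗ₜ[k] b.repr m) i = f (finsuppScalarRight k k V ι (v ⊗ₜ[k] b.repr m) i)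
      rw [finsuppScalarRight_apply_tmul_apply, finsuppScalarRight_apply_tmul_apply, map_smul]
  | add x y hx hy => rw [map_add, map_add, hx, hy, map_add, Finsupp.mapRange_add (map_add f)]

/-- **Every coordinate (along a basis of `M`) of a `K`-fixed vector of `Θ ⊗ 1_M` is `K`-fixed for `Θ`.**
[cite: Flath1979, §2 Example 2] -/
theorem mem_fixedPoints_of_mem_fixedPoints_tprod_trivial {x : V ⊗[k] M}
    (hx : x ∈ (Θ.tprod (Representation.trivial k G M)).fixedPoints K) (i : ι) :
    (TensorProduct.congr (LinearEquiv.refl k V) b.repr).trans (finsuppScalarRight k k V ι) x i ∈ Θ.fixedPoints K := by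
  rw [Representation.mem_fixedPoints] at hx ⊢
  intro g hg
  have h := congrArg
    (fun z => (TensorProduct.congr (LinearEquiv.refl k V) b.repr).trans (finsuppScalarRight k k V ι) z i) (hx g hg)
  simp only [tprod_trivial_apply, coord_rTensor, Finsupp.mapRange_apply] at h
  exact h

/-- **Hecke eigen-scalars pass through `Θ ⊗ 1_M`**: if `[K t K]_Θ` acts by `λ` on all of `Θ^K` (finite double coset),
then `[K t K]_{Θ ⊗ 1_M}` acts by `λ` on all of `(Θ ⊗ 1_M)^K`, for `M` free (any vector space).  Proof: in coordinates along
a basis of `M`, `[K t K]_{Θ ⊗ 1} = [K t K]_Θ ⊗ id` acts coordinatewise and every coordinate of a fixed vector is fixed.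
[cite: Flath1979, §2 Example 2] [cite: Bump1997, Thm. 3.4.4] -/
theorem heckeOperator_tprod_trivial_apply_eq_smul [Module.Free k M] (t : G) (hfin : (orbit K (t : G ⧸ K)).Finite)
    (c : k) (hΘ : ∀ y ∈ Θ.fixedPoints K, heckeOperator Θ K t y = c • y) {x : V ⊗[k] M}
    (hx : x ∈ (Θ.tprod (Representation.trivial k G M)).fixedPoints K) :
    heckeOperator (Θ.tprod (Representation.trivial k G M)) K t x = c • x := by
  classical
  let b := Module.Free.chooseBasis k M
  apply ((TensorProduct.congr (LinearEquiv.refl k V) b.repr).trans (finsuppScalarRight k k V _)).injective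
  rw [heckeOperator_tprod_trivial Θ K t hfin, coord_rTensor, map_smul]
  ext i
  rw [Finsupp.mapRange_apply, Finsupp.smul_apply]
  exact hΘ _ (mem_fixedPoints_of_mem_fixedPoints_tprod_trivial Θ K b hx i)

end TensorTrivial

section Equiv

variable {k G V W : Type*} [CommRing k] [Group G] [AddCommGroup V] [Module k V] [AddCommGroup W] [Module k W]
  {π : Representation k G V} {σ : Representation k G W} (K : Subgroup G)

/-- **An isomorphism of representations intertwines the Hecke operators** (finite double coset; on `K`-fixed vectors,
where both sides are the same finite sum over one transversal): `e ([K t K]_π v) = [K t K]_σ (e v)`.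
[cite: CartierCorvallis1979, §IV.1] -/
theorem heckeOperator_equiv_apply (e : π.Equiv σ) (t : G) (hfin : (orbit K (t : G ⧸ K)).Finite) {v : V}
    (hv : v ∈ π.fixedPoints K) :
    e (heckeOperator π K t v) = heckeOperator σ K t (e v) := by
  classical
  have hev : e v ∈ σ.fixedPoints K := by
    rw [Representation.Equiv.fixedPoints_eq_map e]
    exact Submodule.mem_map_of_mem hv
  obtain ⟨s, hs⟩ : ∃ s : Finset G, Set.BijOn (fun x : G => (x : G ⧸ K)) s (orbit K (t : G ⧸ K)) := by
    refine ⟨hfin.toFinset.image Quotient.out, fun x hx => ?_, fun x hx y hy hxy => ?_, fun γ hγ => ?_⟩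
    · obtain ⟨γ, hγ, rfl⟩ := Finset.mem_image.1 (Finset.mem_coe.1 hx)
      change ((γ.out : G) : G ⧸ K) ∈ _
      rw [QuotientGroup.out_eq']
      exact (Set.Finite.mem_toFinset _).1 hγ
    · obtain ⟨γ, -, rfl⟩ := Finset.mem_image.1 (Finset.mem_coe.1 hx)
      obtain ⟨γ', -, rfl⟩ := Finset.mem_image.1 (Finset.mem_coe.1 hy)
      change ((γ.out : G) : G ⧸ K) = ((γ'.out : G) : G ⧸ K) at hxy
      rw [QuotientGroup.out_eq', QuotientGroup.out_eq'] at hxy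
      rw [hxy]
    · exact ⟨γ.out, Finset.mem_coe.2 (Finset.mem_image.2 ⟨γ, (Set.Finite.mem_toFinset _).2 hγ, rfl⟩),
        QuotientGroup.out_eq' γ⟩
  rw [heckeOperator_apply_eq_sum _ _ _ s hs hv, heckeOperator_apply_eq_sum _ _ _ s hs hev, map_sum]
  refine Finset.sum_congr rfl fun x _ => ?_
  have hx := e.toIntertwiningMap.isIntertwining π σ x v
  rw [Representation.Equiv.coe_toIntertwiningMap] at hx
  exact hx

/-- **Eigen-scalars transport along isomorphisms**: if `[K t K]_π` acts by `λ` on `π^K`, then `[K t K]_σ` acts by `λ` on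
`σ^K` for any `σ ≃ π`-isomorphic representation. [cite: CartierCorvallis1979, §IV.1] -/
theorem heckeOperator_apply_eq_smul_of_equiv (e : π.Equiv σ) (t : G) (hfin : (orbit K (t : G ⧸ K)).Finite) (c : k)
    (hπ : ∀ y ∈ π.fixedPoints K, heckeOperator π K t y = c • y) {x : W} (hx : x ∈ σ.fixedPoints K) :
    heckeOperator σ K t x = c • x := by
  have hy : e.symm x ∈ π.fixedPoints K := by
    rw [Representation.Equiv.fixedPoints_eq_map e.symm]
    exact Submodule.mem_map_of_mem hx
  have h := heckeOperator_equiv_apply K e t hfin hy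
  rw [Representation.Equiv.apply_symm_apply, hπ _ hy, map_smul, Representation.Equiv.apply_symm_apply] at h
  exact h.symm

/-- **Combined form** (the shape used at a split place: the local group acting on a global space): if `σ ≃ Θ ⊗ 1_M` and
`[K t K]_Θ` acts by `λ` on `Θ^K`, then `[K t K]_σ` acts by `λ` on `σ^K`. [cite: Flath1979, §2 Example 2] -/
theorem heckeOperator_apply_eq_smul_of_equiv_tprod_trivial {M U : Type*} [AddCommGroup M] [Module k M] [Module.Free k M]
    [AddCommGroup U] [Module k U] {Θ : Representation k G U} (e : (Θ.tprod (Representation.trivial k G M)).Equiv σ)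
    (t : G) (hfin : (orbit K (t : G ⧸ K)).Finite) (c : k) (hΘ : ∀ y ∈ Θ.fixedPoints K, heckeOperator Θ K t y = c • y)
    {x : W} (hx : x ∈ σ.fixedPoints K) : heckeOperator σ K t x = c • x :=
  heckeOperator_apply_eq_smul_of_equiv K e t hfin c
    (fun _ hy => heckeOperator_tprod_trivial_apply_eq_smul Θ K t hfin c hΘ hy) hx

end Equiv

end Literature.NumberTheory.Automorphic

end
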